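import Literature.Topology.FourManifolds.PiStableFourCollapse
import Literature.Topology.FourManifolds.PontryaginThomCollapseProofs
import Literature.Topology.FourManifolds.HomotopySpheresInverseDischarge
import Literature.Topology.FourManifolds.ThetaFourKervaireMilnorFramedStep
import Literature.Topology.FourManifolds.SurgeryReframingParallelizable
import HarnessLib

/-!
# Kervaire–Milnor's `Θ₄ = 0` chain over its current frontier of named facts

Topic `Literature/Topology/FourManifolds`; pure-proof file attached to `ThetaFourKervaireMilnor.lean`
(the decomposition of the named fact
`Literature.Topology.FourManifolds.isHCobordant_sphere_of_homotopySphere_four`, `Θ₄ = 0` in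
Kervaire–Milnor's h-cobordism sense, along *Groups of homotopy spheres I*, Ann. of Math. 77 (1963):
Lemma 2.3, Thm. 3.1, §4 with `Π₄ = 0`, Thm. 5.1). Everything here is PROVED; no definition, no
named fact and no statement is added or changed (net debt `0`).

## Review of the split child `HomotopySphere.boundsParallelizable_of_isStablyParallelizable_four` (2026-08-15)

The child (an s-parallelizable homotopy `4`-sphere bounds a parallelizable compact `5`-manifold)
was read against the source, pp. 510–512:

* **Faithful and well cut.** It is §4 at `n = 4` with Thm. 3.1 factored out exactly as the text
  does (p. 510: "Given an s-parallelizable closed manifold `M` of dimension `n`, choose an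
  imbedding `i : M → Sⁿ⁺ᵏ` with `k > n + 1` … By Lemma 3.3 the normal bundle of `M` is trivial"),
  followed by Lemma 4.2 (p. 510: "The subset `p(M) ⊂ Πₙ` contains the zero element of `Πₙ` if and
  only if `M` bounds a parallelizable manifold") and the table of the Remarks on p. 512, column
  `n = 4`: `Π₄ = 0`, so that the non-empty set `p(Σ) ⊂ Π₄` is `{0}`. (Lemma 4.5 and the
  `J`-homomorphism, needed at `n = 7` where only `Π₇ / p(S⁷)` vanishes, are not needed at `n = 4`.)
  Not an open problem, not mis-stated; the unoriented reading of "bounds" is equivalent to the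
  printed oriented one for connected `Σ` (module docstring of `ThetaFourKervaireMilnor.lean`).
* **Not provable inline (XL).** Its proof is the Pontryagin–Thom theorem (Thom transversality for a
  smooth null-homotopy `S⁴⁺ᵏ × [0, 1] → Sᵏ`, producing the bounding `W` with a normal framing, and
  Lemmas 3.3–3.4 making `W` parallelizable) together with the computation of the stable stem
  `Π₄ = π₄₊ₖ(Sᵏ) = 0`, `k > 5` (Serre; no homotopy group of a sphere beyond `π₁` is computed in
  Mathlib or in the tree). Both are theories.
* **Already reduced in the tree** (`PiStableFourCollapse.lean`,
  `HomotopySphere.boundsParallelizable_of_isStablyParallelizable_four_of`) to the three general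
  leaves of `PontryaginThomCollapse.lean` / `PiStableFourCollapse.lean`: (a) the normally framed
  embedding `exists_isSmoothEmbedding_isNormalFraming_of_isStablyParallelizable` — since PROVED
  (`exists_isSmoothEmbedding_isNormalFraming_of_isStablyParallelizable_holds`,
  `PontryaginThomCollapseProofs.lean`: Whitney and Lemma 3.3), (b) Lemma 4.2 `⇒`
  (`boundsParallelizable_of_collapseNullHomotopic`) and `Π₄ = 0` (`piStable_four_trivial`,
  equivalently `π₄₊ₖ(Sᵏ) = 0` for Mathlib's `HomotopyGroup`, `PiStableFourHomotopyGroup.lean`).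

Hence the child sits over exactly TWO existing named facts, (b) and `Π₄ = 0`, and its discharge is
`HomotopySphere.boundsParallelizable_of_isStablyParallelizable_four_of_frontier` (below) applied to
their `_holds`, once they exist — the `n = 4` counterpart of
`HomotopySphere.boundsParallelizable_of_isStablyParallelizable_seven_of_frontier`
(`PontryaginThomCollapseProofs.lean`). No further decomposition of the child is needed or intended.

## Proved here

* `HomotopySphere.boundsParallelizable_of_isStablyParallelizable_four_of_frontier`: the child GIVEN
  (b) and `Π₄ = 0` only.
* `HomotopySphere.boundsParallelizable_four_of_frontier`, `HomotopySphere.boundsContractible_four_of_frontier`: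
  `Θ₄ = bP₅` and the bounding form of `Θ₄ = 0` (every homotopy `4`-sphere bounds a contractible
  manifold — the conclusion of `HomotopySphere.boundsContractible_four_of`; not a named fact, being
  equivalent to the target by Lemma 2.3, both directions of which are tree theorems) over Thm. 3.1,
  (b), `Π₄ = 0` (and Thm. 5.1 at `k = 2`).
* `isHCobordant_sphere_of_homotopySphere_four_of_frontier`: **`Θ₄ = 0` over the four remaining
  Kervaire–Milnor leaves** — (3.1) `HomotopySphere.isStablyParallelizable`, (b), `Π₄ = 0`, (5.1 at
  `k = 2`) `HomotopySphere.boundsContractible_of_nullCobordism_isStablyParallelizable_four` — with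
  Lemma 2.3 (`⇐`) now supplied by the tree theorem `isHCobordant_sphere_of_boundsContractible_holds`
  (`HomotopySpheresInverseDischarge.lean`: Whitehead's theorem, duality, ball removal).
* `isHCobordant_sphere_of_homotopySphere_four_of_frontier₄`: the same with Thm. 3.1 required only in
  dimension `4` (the instance fed by `HomotopySphere.isStablyParallelizable_four_of_sig`,
  `HomotopySpheresStablyParallelizableFrontier.lean`: Kosinski IX (8.5) at `m = 4`).

## References

* M. Kervaire, J. Milnor, *Groups of homotopy spheres I*, Ann. of Math. (2) 77 (1963), 504–537:
  Lemma 2.3 (p. 506), Thm. 3.1 (p. 508), Lemmas 3.3–3.4 (p. 509), §4: p. 510 (proof of Thm. 4.1,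
  first paragraph; Lemma 4.2), Remarks and table p. 512 (`Π₄ = 0`), Thm. 5.1 (p. 512).
  doi:10.2307/1970128 [KervaireMilnorAnnals1963]
-/

noncomputable section

open scoped Manifold ContDiff

namespace Literature.Topology.FourManifolds

namespace HomotopySphere

/-- **Kervaire–Milnor's §4 at `n = 4` over the current frontier.** An s-parallelizable homotopy
`4`-sphere bounds a parallelizable manifold
(`HomotopySphere.boundsParallelizable_of_isStablyParallelizable_four`) GIVEN only (b) Lemma 4.2, `⇒`
(`boundsParallelizable_of_collapseNullHomotopic`: a framed tubular embedding with null-homotopic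
Pontryagin–Thom collapse bounds a parallelizable manifold) and `Π₄ = 0` (`piStable_four_trivial`:
every `S⁴⁺ᵏ → ℝᵏ ∪ {∞}`, `k > 5`, is null-homotopic; table p. 512) — the glue
`boundsParallelizable_of_isStablyParallelizable_four_of` (`PiStableFourCollapse.lean`) with its
input (a), the normally framed embedding `Σ ↪ S⁴⁺⁶` (p. 510, first paragraph: Whitney and
Lemma 3.3), fed by the tree's discharge
`exists_isSmoothEmbedding_isNormalFraming_of_isStablyParallelizable_holds`. The discharge of the
named fact is this theorem applied to the `_holds` of (b) and `Π₄ = 0`.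
[cite: KervaireMilnorAnnals1963, §4, p. 510 (proof of Thm. 4.1, Lemma 4.2) and table p. 512 (Π₄ = 0)] -/
theorem boundsParallelizable_of_isStablyParallelizable_four_of_frontier
    (hb : boundsParallelizable_of_collapseNullHomotopic) (hPi : piStable_four_trivial) :
    boundsParallelizable_of_isStablyParallelizable_four :=
  boundsParallelizable_of_isStablyParallelizable_four_of
    exists_isSmoothEmbedding_isNormalFraming_of_isStablyParallelizable_holds hb hPi

/-- **`Θ₄ = bP₅` over the current frontier**: every homotopy `4`-sphere bounds a parallelizable
(compact, smooth, `5`-dimensional) manifold (`HomotopySphere.BoundsParallelizable`; stated in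
unfolded form, `∀ S : HomotopySphere 4, S.BoundsParallelizable`, so that only the two leaves Thm. 3.1
and §4 (`n = 4`) of `ThetaFourKervaireMilnor.lean` — and no intermediate name for their conjunction
`Θ₄ = bP₅` — enter this file) GIVEN Thm. 3.1 (`isStablyParallelizable`), (b) Lemma 4.2 `⇒` and
`Π₄ = 0` — `boundsParallelizable_four_of` (`ThetaFourKervaireMilnor.lean`) over
`boundsParallelizable_of_isStablyParallelizable_four_of_frontier`.
[cite: KervaireMilnorAnnals1963, Thm. 3.1 (p. 508) and §4 (p. 510, table p. 512: Θ₄/bP₅ ↪ Π₄/p(S⁴) = 0)] -/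
theorem boundsParallelizable_four_of_frontier (h31 : isStablyParallelizable)
    (hb : boundsParallelizable_of_collapseNullHomotopic) (hPi : piStable_four_trivial) :
    ∀ S : HomotopySphere 4, S.BoundsParallelizable :=
  boundsParallelizable_four_of h31
    (boundsParallelizable_of_isStablyParallelizable_four_of_frontier hb hPi)

/-- **`Θ₄ = 0`, bounding form, over the current frontier**: every homotopy `4`-sphere bounds a
contractible manifold (the conclusion of `boundsContractible_four_of`, `ThetaFourKervaireMilnor.lean`)
GIVEN Thm. 3.1, (b) Lemma 4.2 `⇒`, `Π₄ = 0` and Thm. 5.1 at `k = 2`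
(`boundsContractible_of_nullCobordism_isStablyParallelizable_four`) — `boundsContractible_four_of`
over `boundsParallelizable_four_of_frontier`.
[cite: KervaireMilnorAnnals1963, §4–§5, p. 512 (bP₅ = 0 = Θ₄/bP₅)] -/
theorem boundsContractible_four_of_frontier (h31 : isStablyParallelizable)
    (hb : boundsParallelizable_of_collapseNullHomotopic) (hPi : piStable_four_trivial)
    (h51 : boundsContractible_of_nullCobordism_isStablyParallelizable_four) :
    ∀ S : HomotopySphere 4, BoundsContractible 4 S.carrier :=
  boundsContractible_four_of (boundsParallelizable_four_of_frontier h31 hb hPi) h51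

end HomotopySphere

/-- **`Θ₄ = 0` (h-cobordism form) over the four remaining Kervaire–Milnor leaves.** Every homotopy
`4`-sphere is h-cobordant to `S⁴` (`isHCobordant_sphere_of_homotopySphere_four`) GIVEN (3.1)
`HomotopySphere.isStablyParallelizable`, (b) Lemma 4.2 `⇒`
(`boundsParallelizable_of_collapseNullHomotopic`), `Π₄ = 0` (`piStable_four_trivial`) and (5.1 at
`k = 2`) `HomotopySphere.boundsContractible_of_nullCobordism_isStablyParallelizable_four`; the two
other leaves of `isHCobordant_sphere_of_homotopySphere_four_of_collapseLeaves`
(`PiStableFourCollapse.lean`) are tree theorems: Lemma 2.3, `⇐`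
(`isHCobordant_sphere_of_boundsContractible_holds`, `HomotopySpheresInverseDischarge.lean`) and (a)
the normally framed embedding (`exists_isSmoothEmbedding_isNormalFraming_of_isStablyParallelizable_holds`).
[cite: KervaireMilnorAnnals1963, table p. 504 (Θ₄ = 0) via Lemma 2.3, Thm. 3.1, §4 (Lemma 4.2, table p. 512) and Thm. 5.1] -/
theorem isHCobordant_sphere_of_homotopySphere_four_of_frontier
    (h31 : HomotopySphere.isStablyParallelizable)
    (hb : boundsParallelizable_of_collapseNullHomotopic) (hPi : piStable_four_trivial)
    (h51 : HomotopySphere.boundsContractible_of_nullCobordism_isStablyParallelizable_four) :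
    isHCobordant_sphere_of_homotopySphere_four :=
  isHCobordant_sphere_of_homotopySphere_four_of isHCobordant_sphere_of_boundsContractible_holds
    (HomotopySphere.boundsContractible_four_of_frontier h31 hb hPi h51)

/-- **`Θ₄ = 0` over the frontier, with Thm. 3.1 only in dimension `4`.** As
`isHCobordant_sphere_of_homotopySphere_four_of_frontier`, but requiring the s-parallelizability of
homotopy spheres only for `n = 4` — the instance produced by
`HomotopySphere.isStablyParallelizable_four_of_sig` (`HomotopySpheresStablyParallelizableFrontier.lean`,
Case 2 of the printed proof of Thm. 3.1 at `n = 4`: Kosinski IX (8.5) at `m = 4`) — instead of the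
all-`n` named fact `HomotopySphere.isStablyParallelizable`.
[cite: KervaireMilnorAnnals1963, table p. 504 (Θ₄ = 0) via Lemma 2.3, Thm. 3.1 (n = 4), §4 (Lemma 4.2, table p. 512) and Thm. 5.1] -/
theorem isHCobordant_sphere_of_homotopySphere_four_of_frontier₄
    (h31 : ∀ S : HomotopySphere 4, IsStablyParallelizable (𝓡 4) S.carrier)
    (hb : boundsParallelizable_of_collapseNullHomotopic) (hPi : piStable_four_trivial)
    (h51 : HomotopySphere.boundsContractible_of_nullCobordism_isStablyParallelizable_four) :
    isHCobordant_sphere_of_homotopySphere_four :=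
  isHCobordant_sphere_of_homotopySphere_four_of isHCobordant_sphere_of_boundsContractible_holds
    (HomotopySphere.boundsContractible_four_of
      (fun S => HomotopySphere.boundsParallelizable_of_isStablyParallelizable_four_of_frontier
        hb hPi S (h31 S)) h51)

/-! ### Discharge of Thm. 5.1 (`n = 4`, `k` even): `HomotopySphere.boundsContractible_of_nullCobordism_isStablyParallelizable_four` -/

/-- **Kervaire–Milnor, Theorem 5.1 at `n = 4` (discharge of the named fact
`HomotopySphere.boundsContractible_of_nullCobordism_isStablyParallelizable_four`).** A homotopy
`4`-sphere bounding an s-parallelizable compact `5`-manifold bounds a contractible one.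
Proof as printed (§5, pp. 513–515, and §6 Lemmas 6.1–6.2, pp. 520–522): framed surgery below the
middle dimension on the interior of the null-cobordism. The homological / Whitney / re-framing
reductions are `boundsContractible_of_nullCobordism_isStablyParallelizable_four_of_reframing`
(`ThetaFourKervaireMilnorFramedStep.lean`); the re-framing hypotheses `hF₁` (`k = 1`, circles) and
`hF₂` (`k = 2`, `2`-spheres) are Lemma 5.4 / Lemma 6.2 — after twisting the framing of the sphere,
the surgered manifold is again s-parallelizable — proved in
`FramedSphereFamily.exists_twist_isStablyParallelizable_surgered` (`SurgeryReframingParallelizable.lean`,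
resting on the cylinder-frame files `SurgeryCylinderFrames` … `SurgeryHandleCylinderFrame`).
[cite: KervaireMilnorAnnals1963, Thm. 5.1 (p. 512), Lemma 5.4 (p. 514), Lemmas 6.1–6.2 (pp. 520–522)] -/
theorem HomotopySphere.boundsContractible_of_nullCobordism_isStablyParallelizable_four_holds :
    HomotopySphere.boundsContractible_of_nullCobordism_isStablyParallelizable_four :=
  HomotopySphere.boundsContractible_of_nullCobordism_isStablyParallelizable_four_of_reframing
    (fun _ c _ hW ν => by
      obtain ⟨T, hT⟩ := ν.exists_twist_isStablyParallelizable_surgered (rfl : 1 + 3 = 4) (by norm_num) hW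
      exact ⟨ν.twist fun _ => T, FramedSphereFamily.twist_sphereMap _ _, hT⟩)
    (fun _ c _ hW ν => by
      obtain ⟨T, hT⟩ := ν.exists_twist_isStablyParallelizable_surgered (rfl : 2 + 2 = 4) (by norm_num) hW
      exact ⟨ν.twist fun _ => T, FramedSphereFamily.twist_sphereMap _ _, hT⟩)

end Literature.Topology.FourManifolds

end
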